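/-
Copyright (c) 2026 the pub-hodgecm-mathlib formalisation cell (harness21).  Prover seat hodgecm-mathlib-A-p06 (g29) — F0∕P6 DICT organ (o-c2i) «Ω-points are defined over finite
subextensions» (dealing desk F0P6c-plan (g0) 14:37:54Z; LEAD F0P6-plan (g0) M-6c).
-/
import Literature.NumberTheory.DiophantineGeometry.AVGaloisModuleProofs   -- ★ `AlgPoints.exists_fixingSubgroup_le_stabilizer` (same route, Galois form) + ★ `AlgPoints.extendScalars`∕`specOverMap` (AVGaloisModule)
import HarnessLib

/-!
# Points of a scheme locally of finite type with values in a field extension FACTOR THROUGH FINITE SUBEXTENSIONS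
# (Serre, *Cohomologie galoisienne* II §1.1 axiom (1) «`A(K) = lim→ A(K_i)`»; Görtz–Wedhorn §(5.2) Prop. 5.4, (4.9); EGA IV₃ (8.8.2))

Topic `Literature/AlgebraicGeometry/Motives`, namespace `Literature.AlgebraicGeometry.Motives.AlgPoints`.  THEOREMS ONLY (no definition, no instance, no notation,
no named fact, no `sorry`).  Cell `pub/hodgecm-mathlib`, F0∕P6 (crux HLiu418 = `stmt-HodgeConjecture-24832`, supports only), DICT organ (o-c2i) for F0P6c-plan (g0):
the DICT's `sp`∕`red` read every `Ω`-point `y` of the moduli space and every `Ω`-line over a FINITE `L ∕ F_w`, so closures are taken over the DVR `𝒪_L`.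
HONEST LABEL: HC_CM is proved only modulo the 2 remaining named inputs (hLiu418 24832, h413 24833) until rung 0 closes; this is textbook scheme theory.

SETTING (the tree's currency, nothing new): `k` a field, `X : SchemeOver k` locally of finite type (`[LocallyOfFiniteType X.hom]`), `Ω` a field over `k`,
`AlgPoints X Ω = (specOver k Ω ⟶ X)` (★ `Motives/AlgPoints`), and for an intermediate field `E` of `Ω ∕ k` the extension of scalars
★ `AlgPoints.extendScalars X E Ω P₀ = specOverMap E Ω ≫ P₀` (`NumberTheory/DiophantineGeometry/AVGaloisModule`; injective, ★ `extendScalars_injective`).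

THE ARGUMENT (= Steps 1–5 of ★ `AlgPoints.exists_fixingSubgroup_le_stabilizer`, which exports only the Galois consequence): `Spec Ω` is one point, so `P` factors
through an affine open `f : Spec R ↪ X` (Mathlib `Scheme.exists_affine_mem_range_and_range_subset`, `IsOpenImmersion.lift`), `P = Spec ψ ≫ f` with `ψ : R → Ω` a
`k`-algebra map and `R` of finite type over `k` (`HasRingHomProperty.Spec_iff`), generated by a finite `s`; for EVERY intermediate field `E ⊇ ψ(s)` the map `ψ` lands in
`E` (`Algebra.adjoin_le`), so `P = (Spec Ω → Spec E) ≫ (Spec ψ_E ≫ f)`.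
* §1 **`exists_finset_forall_le_exists_extendScalars_eq`** — `∃ S : Finset Ω, ∀ E ⊇ k(S), ∃ P₀ : X(E), extendScalars X E Ω P₀ = P` (no algebraicity; monotone in `E`
  by construction).
* §2 (`Ω ∕ k` algebraic) **`exists_finiteDimensional_extendScalars_eq`** — ONE point over a finite `E`; **`exists_finiteDimensional_forall_extendScalars_eq`** — FINITELY
  MANY points over ONE common finite `E` (`E = k(⋃ Sᵢ)`, Mathlib `IntermediateField.finiteDimensional_adjoin`).

## References
* J.-P. Serre, *Galois Cohomology* (Springer 1997; *Cohomologie galoisienne*, LNM 5), Chap. II §1.1, axiom (1) and Remarque 2. [SerreGaloisCohomology1997]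
* U. Görtz, T. Wedhorn, *Algebraic Geometry I*, 2nd ed. (2020), §(5.2) Prop. 5.4, §(4.9). [GortzWedhorn2020]
* A. Grothendieck, *EGA IV₃*, Publ. Math. IHÉS 28 (1966), (8.8.2). [EGAIV3]
* R. Hartshorne, *Algebraic Geometry* (1977), II Ex. 2.7. [Hartshorne1977]
-/

universe u

open CategoryTheory AlgebraicGeometry

noncomputable section

namespace Literature.AlgebraicGeometry.Motives

namespace AlgPoints

variable {k : Type u} [Field k] {X : SchemeOver k} {Ω : Type u} [Field Ω] [Algebra k Ω]

/-! ## §1 The finite set of coordinates of a point -/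

/-- **A point factors through every subfield containing its coordinates**: for `X` locally of finite type over `k` and `P ∈ X(Ω)` there is a finite set `S ⊆ Ω` — the
images of finitely many generators of an affine open neighbourhood's coordinate ring — such that for EVERY intermediate field `E ⊇ k(S)` the point `P` is the extension of
scalars of a (necessarily unique, ★ `extendScalars_injective`) point `P₀ ∈ X(E)`.  No algebraicity of `Ω ∕ k` is needed.
[cite: SerreGaloisCohomology1997, II.§1.1 axiom (1) and Remarque 2] [cite: GortzWedhorn2020, §(5.2) Prop. 5.4] -/
theorem exists_finset_forall_le_exists_extendScalars_eq [LocallyOfFiniteType X.hom] (P : AlgPoints X Ω) :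
    ∃ S : Finset Ω, ∀ E : IntermediateField k Ω, IntermediateField.adjoin k (S : Set Ω) ≤ E →
      ∃ P₀ : AlgPoints X E, extendScalars X E Ω P₀ = P := by
  classical
  -- Step 1: an affine open `f : Spec R ⟶ X` through which `P` factors (`Spec Ω` is a point).
  obtain ⟨R, f, hf, hxf, -⟩ := Scheme.exists_affine_mem_range_and_range_subset
    (X := X.left) (U := ⊤) (x := P.left (default : ↥(Spec (CommRingCat.of Ω))))
    (TopologicalSpace.Opens.mem_top _)
  have hrange : Set.range P.left ⊆ Set.range f := by
    rintro _ ⟨p, rfl⟩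
    have hp : p = (default : ↥(Spec (CommRingCat.of Ω))) :=
      Subsingleton.elim (α := ↥(Spec (CommRingCat.of Ω))) _ _
    rw [hp]
    exact hxf
  -- Step 2: `P = Spec ψ ≫ f` for a ring map `ψ : R → Ω` (`Spec` is full).
  obtain ⟨ψ, hψ⟩ : ∃ ψ : R ⟶ CommRingCat.of Ω, Spec.map ψ ≫ f = P.left :=
    ⟨Spec.preimage (IsOpenImmersion.lift f P.left hrange), by
      rw [Spec.map_preimage, IsOpenImmersion.lift_fac]⟩
  -- Step 3: the structure map `θ : k → R` of the affine open is of finite type.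
  obtain ⟨θ, hθ⟩ : ∃ θ : CommRingCat.of k ⟶ R, Spec.map θ = f ≫ X.hom := Spec.map_surjective _
  have hθft : θ.hom.FiniteType := by
    have : LocallyOfFiniteType (Spec.map θ) := by rw [hθ]; infer_instance
    exact (HasRingHomProperty.Spec_iff (P := @LocallyOfFiniteType)).mp this
  -- Step 4: `ψ ∘ θ` is the structure map `k → Ω`, because `P` is a morphism over `Spec k`.
  have hθψ : θ ≫ ψ = CommRingCat.ofHom (algebraMap k Ω) := by
    apply Spec.map_injective
    rw [Spec.map_comp, hθ, ← Category.assoc, hψ]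
    exact Over.w P
  -- Step 5: a finite generating set `s` of `R` over `k`; the finite set of coordinates `S = ψ(s)`.
  letI : Algebra k R := θ.hom.toAlgebra
  have hft : Algebra.FiniteType k R := hθft
  obtain ⟨s, hs⟩ := hft.out
  let ψ' : R →ₐ[k] Ω :=
    { ψ.hom with
      commutes' := fun c => by
        have h := congrArg (fun φ : CommRingCat.of k ⟶ CommRingCat.of Ω => φ.hom c) hθψ
        exact h }
  have hψ' : ∀ r : R, ψ' r = ψ.hom r := fun _ => rfl
  refine ⟨s.image ψ.hom, fun E hE => ?_⟩
  -- Step 6: `ψ` lands in every `E ⊇ k(ψ(s))`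
  have hrangeE : ∀ r : R, ψ.hom r ∈ E := by
    intro r
    have hr : r ∈ Algebra.adjoin k (s : Set R) := by rw [hs]; exact Algebra.mem_top
    have hmap : ψ' r ∈ (Algebra.adjoin k (s : Set R)).map ψ' := Subalgebra.mem_map.2 ⟨r, hr, rfl⟩
    rw [AlgHom.map_adjoin] at hmap
    have hle : Algebra.adjoin k (ψ' '' (s : Set R)) ≤ E.toSubalgebra := by
      refine (IntermediateField.algebra_adjoin_le_adjoin k _).trans ?_
      have hSE : IntermediateField.adjoin k (ψ' '' (s : Set R)) ≤ E := by
        refine le_trans (le_of_eq ?_) hE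
        congr 1
        ext x
        simp only [Set.mem_image, Finset.coe_image, hψ']
      exact hSE
    exact hle hmap
  -- the corestriction `ψ_E : R → E` and the point `P₀ = Spec ψ_E ≫ f` over `E`
  let ψE : R →+* E := (ψ.hom).codRestrict E hrangeE
  have hψE : (algebraMap E Ω).comp ψE = ψ.hom := RingHom.ext fun _ => rfl
  have hθE : θ ≫ CommRingCat.ofHom ψE = CommRingCat.ofHom (algebraMap k E) := by
    ext c
    change ψ.hom (θ.hom c) = algebraMap E Ω (algebraMap k E c)
    rw [← IsScalarTower.algebraMap_apply k E Ω]
    exact congrArg (fun φ : CommRingCat.of k ⟶ CommRingCat.of Ω => φ.hom c) hθψ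
  refine ⟨AlgPoints.mk (Spec.map (CommRingCat.ofHom ψE) ≫ f) ?_, ?_⟩
  · rw [Category.assoc, ← hθ, ← Spec.map_comp, hθE]
  · apply Over.OverMorphism.ext
    change Spec.map (CommRingCat.ofHom (algebraMap E Ω)) ≫ (Spec.map (CommRingCat.ofHom ψE) ≫ f) = P.left
    rw [← Category.assoc, ← Spec.map_comp, ← CommRingCat.ofHom_comp, hψE, CommRingCat.ofHom_hom, hψ]

/-! ## §2 Algebraic extensions: one finite subextension for one point, and for finitely many points -/

/-- **POINTS ARE DEFINED OVER FINITE SUBEXTENSIONS**: for `X` locally of finite type over `k`, `Ω ∕ k` algebraic and `P ∈ X(Ω)`, there is an intermediate field `E`,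
FINITE over `k`, and `P₀ ∈ X(E)` with `P = extendScalars X E Ω P₀` (`E = k(S)` for the finite coordinate set `S` of §1; Mathlib `IntermediateField.finiteDimensional_adjoin`).
[cite: SerreGaloisCohomology1997, II.§1.1 axiom (1) and Remarque 2] [cite: GortzWedhorn2020, §(5.2) Prop. 5.4] -/
theorem exists_finiteDimensional_extendScalars_eq [LocallyOfFiniteType X.hom] [Algebra.IsAlgebraic k Ω] (P : AlgPoints X Ω) :
    ∃ (E : IntermediateField k Ω) (_ : FiniteDimensional k E) (P₀ : AlgPoints X E), extendScalars X E Ω P₀ = P := by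
  obtain ⟨S, hS⟩ := exists_finset_forall_le_exists_extendScalars_eq P
  obtain ⟨P₀, hP₀⟩ := hS (IntermediateField.adjoin k (S : Set Ω)) le_rfl
  haveI : Finite (S : Set Ω) := S.finite_toSet.to_subtype
  exact ⟨IntermediateField.adjoin k (S : Set Ω), IntermediateField.finiteDimensional_adjoin fun x _ => Algebra.IsIntegral.isIntegral x, P₀, hP₀⟩

/-- **FINITELY MANY POINTS ARE DEFINED OVER ONE COMMON FINITE SUBEXTENSION**: for `X` locally of finite type over `k`, `Ω ∕ k` algebraic and finitely many points
`P i ∈ X(Ω)`, there is ONE intermediate field `E`, finite over `k`, over which EVERY `P i` is defined (`E = k(⋃ᵢ Sᵢ)`, the compositum of the §1 coordinate fields).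
[cite: SerreGaloisCohomology1997, II.§1.1 axiom (1) and Remarque 2] [cite: GortzWedhorn2020, §(5.2) Prop. 5.4] -/
theorem exists_finiteDimensional_forall_extendScalars_eq [LocallyOfFiniteType X.hom] [Algebra.IsAlgebraic k Ω] {ι : Type*} [Finite ι] (P : ι → AlgPoints X Ω) :
    ∃ (E : IntermediateField k Ω) (_ : FiniteDimensional k E), ∀ i, ∃ P₀ : AlgPoints X E, extendScalars X E Ω P₀ = P i := by
  classical
  haveI := Fintype.ofFinite ι
  choose S hS using fun i => exists_finset_forall_le_exists_extendScalars_eq (P i)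
  refine ⟨IntermediateField.adjoin k ((Finset.univ.biUnion S : Finset Ω) : Set Ω), ?_, fun i => hS i _ ?_⟩
  · haveI : Finite ((Finset.univ.biUnion S : Finset Ω) : Set Ω) := (Finset.finite_toSet _).to_subtype
    exact IntermediateField.finiteDimensional_adjoin fun x _ => Algebra.IsIntegral.isIntegral x
  · exact IntermediateField.adjoin.mono k _ _ (Finset.coe_subset.2 (Finset.subset_biUnion_of_mem S (Finset.mem_univ i)))

/-- Monotonicity: a point defined over `E` is defined over every larger intermediate field `E'` (re-extend the scalars along `E → E'`; stated through §1's finite set, so no tower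
instance between subfields is needed). [cite: GortzWedhorn2020, §(5.2) Prop. 5.4] -/
theorem exists_extendScalars_eq_of_le [LocallyOfFiniteType X.hom] (P : AlgPoints X Ω) :
    ∃ S : Finset Ω, ∀ E E' : IntermediateField k Ω, IntermediateField.adjoin k (S : Set Ω) ≤ E → E ≤ E' →
      ∃ P₀' : AlgPoints X E', extendScalars X E' Ω P₀' = P := by
  obtain ⟨S, hS⟩ := exists_finset_forall_le_exists_extendScalars_eq P
  exact ⟨S, fun E E' hE hEE' => hS E' (hE.trans hEE')⟩

end AlgPoints

end Literature.AlgebraicGeometry.Motives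

end
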